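import Literature.AlgebraicGeometry.Resolution.CompletedPullbackRegular
import Literature.AlgebraicGeometry.Resolution.RegularLocalRingsFlatDescent
import Mathlib.RingTheory.RingHom.FaithfullyFlat
import Mathlib.RingTheory.RingHom.Flat
import Mathlib.LinearAlgebra.TensorProduct.Finiteness
import Mathlib.Algebra.Field.Subfield.Basic

/-!
# `Descent.DescentPerfectToAll`, line `arc-special-fibre-transversality`: regularity at the limit

Route `ResolutionOfSingularities/Descent`, crux `DescentPerfectToAll`
(stmt-ResolutionOfSingularities-0549), stub `stub_regularOfFiniteLevels` of the lead's skeleton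
`work/DescentPerfectToAll.lean`, PROVED here (statement verbatim from the ledger registration).

**Statement (REGULARITY OF THE LIMIT).** Let `k` be a field, `L = closure t ⊆ k` a finitely
generated subfield, `q : Y → Spec L` locally of finite type (and quasi-compact). Suppose that for
every finitely generated subfield `L ≤ L' = closure t' ⊆ k` there are a field `Ω` and a ring map
`φ : L' → Ω` with `Y ×_L Ω` (base change along `φ ∘ (L ↪ L')`) regular. Then `Y ×_L k` is regular.

**Proof (characteristic free, no Kunz).** Fix a point `y` of `Y ×_L k`, an affine open
`Spec B ∋ pr₁ y` of `Y` (`B` of finite type over `L`) and the chart `Spec (B ⊗_L k) → Y ×_L k`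
(`specTensorChart`), so that `𝒪_y ≅ (B ⊗_L k)_𝔓`. The prime `𝔓` of the Noetherian ring
`B ⊗_L k` is finitely generated; collecting the finitely many scalars of `k` occurring in a choice
of generators gives a finitely generated `L' = closure (t ∪ C)` such that `𝔓` is extended from
`𝔓' = 𝔓 ∩ (B ⊗_L L')` along `ι : B ⊗_L L' → B ⊗_L k`. Now

* `(B ⊗_L L')_{𝔓'}` is regular: `B ⊗_L L' → B ⊗_L Ω` is faithfully flat (base change of the
  field extension `L' → Ω`), so some prime `𝔔` of `B ⊗_L Ω` lies over `𝔓'`,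
  `(B ⊗_L Ω)_𝔔 ≅ 𝒪_{Y ×_L Ω, 𝔔}` is regular by hypothesis, and regularity DESCENDS along the flat
  local map `(B ⊗_L L')_{𝔓'} → (B ⊗_L Ω)_𝔔` (Matsumura 23.7 (i), in-tree
  `IsRegularLocalRing.of_flat_ringHom`);
* `(B ⊗_L k)_𝔓` is regular: `ι_𝔓 : (B ⊗_L L')_{𝔓'} → (B ⊗_L k)_𝔓` is flat (base change of
  `L' → k`), local, and `𝔓' (B ⊗_L k)_𝔓 = 𝔓 (B ⊗_L k)_𝔓` is the maximal ideal, so regularity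
  ASCENDS (Matsumura 23.7 (ii) with trivial closed fibre, in-tree
  `IsRegularLocalRing.of_flat_of_map_maximalIdeal_eq`).
-/

noncomputable section

set_option linter.dupNamespace false -- mandated namespace of this single-conjunct summit

open CategoryTheory CategoryTheory.Limits AlgebraicGeometry TopologicalSpace TensorProduct
  IsLocalRing
open Literature.AlgebraicGeometry.Resolution

namespace Summit.ResolutionOfSingularities.ResolutionOfSingularities.Theorems

universe u

/-! ## Ring level: base change of the right tensor factor along a field extension -/

section Ring

/-- Faithful flatness is preserved by `A ⊗_R -`: if `f : B → D` is a faithfully flat `R`-algebra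
map then so is `A ⊗_R B → A ⊗_R D` (it is the base change of `f` along `B → A ⊗_R B`; the flat
analogue is Mathlib's `RingHom.Flat.lTensor`). -/
theorem faithfullyFlat_lTensor {R S A B D : Type*} [CommRing R] [CommRing S] [Algebra R S]
    [CommRing A] [Algebra R A] [Algebra S A] [IsScalarTower R S A] [CommRing B] [Algebra R B]
    [CommRing D] [Algebra R D] {f : B →ₐ[R] D} (hf : f.toRingHom.FaithfullyFlat) :
    (Algebra.TensorProduct.lTensor (S := S) A f).toRingHom.FaithfullyFlat := by
  letI : Algebra B (A ⊗[R] B) := Algebra.TensorProduct.rightAlgebra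
  algebraize [f.toRingHom, (Algebra.TensorProduct.lTensor (S := A) A f).toRingHom]
  let e : A ⊗[R] D ≃ₐ[A ⊗[R] B] (A ⊗[R] B) ⊗[B] D :=
    { __ := (Algebra.IsPushout.cancelBaseChangeAlg _ _ _ _ _).symm,
      commutes' x := congr($(Algebra.IsPushout.cancelBaseChange_symm_comp_lTensor R B D A) x) }
  exact .of_linearEquiv _ _ e.toLinearEquiv

variable {R L' E B : Type u} [CommRing R] [Field L'] [CommRing E] [Algebra R L'] [Algebra R E]
  [Algebra L' E] [IsScalarTower R L' E] [CommRing B] [Algebra R B]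

/-- An element of `B ⊗_R E` which is a finite sum of tensors `b ⊗ c` with all `c` in the image
of `L'` comes from `B ⊗_R L'`. -/
theorem sum_tmul_mem_range_lTensor (F : Finset (B × E))
    (hF : ∀ i ∈ F, i.2 ∈ Set.range (algebraMap L' E)) :
    ∑ i ∈ F, i.1 ⊗ₜ[R] i.2 ∈ Set.range
      (Algebra.TensorProduct.lTensor (S := R) B (IsScalarTower.toAlgHom R L' E)).toRingHom := by
  suffices h : ∑ i ∈ F, i.1 ⊗ₜ[R] i.2 ∈
      (Algebra.TensorProduct.lTensor (S := R) B (IsScalarTower.toAlgHom R L' E)).range by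
    obtain ⟨x, hx⟩ := (AlgHom.mem_range _).mp h
    exact ⟨x, hx⟩
  refine sum_mem fun i hi => ?_
  obtain ⟨c, hc⟩ := hF i hi
  exact (AlgHom.mem_range _).mpr ⟨i.1 ⊗ₜ[R] c, by simp [← hc]⟩

/-- **Ascent at the limit.** Let `ι : B ⊗_R L' → B ⊗_R E` be the base change of the structure
map of an `L'`-algebra `E`, `L'` a field (so `ι` is flat), with `B ⊗_R E` Noetherian, and let
`𝔓` be a prime of `B ⊗_R E` extended from `𝔓' = ι⁻¹ 𝔓`. If `(B ⊗_R L')_{𝔓'}` is regular then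
`(B ⊗_R E)_𝔓` is regular: `ι_𝔓` is flat and local with `𝔓' (B ⊗_R E)_𝔓` the maximal ideal
(Matsumura 23.7 (ii), trivial closed fibre). -/
theorem isRegularLocalRing_localization_of_le_map_comap [IsNoetherianRing (B ⊗[R] E)]
    (𝔓 : Ideal (B ⊗[R] E)) [𝔓.IsPrime]
    (hgen : 𝔓 ≤ (𝔓.comap
      (Algebra.TensorProduct.lTensor (S := R) B (IsScalarTower.toAlgHom R L' E)).toRingHom).map
      (Algebra.TensorProduct.lTensor (S := R) B (IsScalarTower.toAlgHom R L' E)).toRingHom)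
    (hreg : IsRegularLocalRing (Localization.AtPrime (𝔓.comap
      (Algebra.TensorProduct.lTensor (S := R) B (IsScalarTower.toAlgHom R L' E)).toRingHom))) :
    IsRegularLocalRing (Localization.AtPrime 𝔓) := by
  set ι := (Algebra.TensorProduct.lTensor (S := R) B (IsScalarTower.toAlgHom R L' E)).toRingHom
    with hι
  set 𝔓' := 𝔓.comap ι with h𝔓'
  have hflat : ι.Flat :=
    RingHom.Flat.lTensor B (RingHom.Flat.of_isField (Field.toIsField L') _)
  set f := Localization.localRingHom 𝔓' 𝔓 ι h𝔓' with hfdef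
  have hf : f.Flat := hflat.localRingHom 𝔓 𝔓' h𝔓'
  letI : Algebra (Localization.AtPrime 𝔓') (Localization.AtPrime 𝔓) := f.toAlgebra
  haveI : Module.Flat (Localization.AtPrime 𝔓') (Localization.AtPrime 𝔓) := hf
  haveI : IsLocalHom (algebraMap (Localization.AtPrime 𝔓') (Localization.AtPrime 𝔓)) :=
    Localization.isLocalHom_localRingHom 𝔓' 𝔓 ι h𝔓'
  haveI := hreg
  refine IsRegularLocalRing.of_flat_of_map_maximalIdeal_eq (Localization.AtPrime 𝔓')
    (Localization.AtPrime 𝔓) ?_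
  change (maximalIdeal (Localization.AtPrime 𝔓')).map f = maximalIdeal (Localization.AtPrime 𝔓)
  rw [← Localization.AtPrime.map_eq_maximalIdeal, ← Localization.AtPrime.map_eq_maximalIdeal,
    Ideal.map_map]
  have hcomp : f.comp (algebraMap (B ⊗[R] L') (Localization.AtPrime 𝔓')) =
      (algebraMap (B ⊗[R] E) (Localization.AtPrime 𝔓)).comp ι :=
    RingHom.ext fun b => Localization.localRingHom_to_map 𝔓' 𝔓 ι h𝔓' b
  have hP : 𝔓'.map ι = 𝔓 := le_antisymm (Ideal.map_le_iff_le_comap.mpr le_rfl) hgen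
  rw [hcomp, ← Ideal.map_map, hP]

/-- **Descent from an overfield.** Let `L' → Ω` be an extension of fields and `B ⊗_R L'`
Noetherian. If every local ring of `B ⊗_R Ω` is regular then every local ring of `B ⊗_R L'` is
regular: `B ⊗_R L' → B ⊗_R Ω` is faithfully flat, so every prime `𝔓'` lies under a prime `𝔔`,
and regularity descends along the flat local map `(B ⊗_R L')_{𝔓'} → (B ⊗_R Ω)_𝔔`
(Matsumura 23.7 (i)). -/
theorem isRegularLocalRing_localization_of_overfield {Ω : Type u} [Field Ω] [Algebra R Ω]
    [Algebra L' Ω] [IsScalarTower R L' Ω] [IsNoetherianRing (B ⊗[R] L')]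
    (hreg : ∀ 𝔔 : PrimeSpectrum (B ⊗[R] Ω), IsRegularLocalRing (Localization.AtPrime 𝔔.asIdeal))
    (𝔓' : Ideal (B ⊗[R] L')) [𝔓'.IsPrime] :
    IsRegularLocalRing (Localization.AtPrime 𝔓') := by
  set ι := (Algebra.TensorProduct.lTensor (S := R) B (IsScalarTower.toAlgHom R L' Ω)).toRingHom
    with hι
  have hff : ι.FaithfullyFlat := by
    refine faithfullyFlat_lTensor (S := R) (A := B) ?_
    exact RingHom.faithfullyFlat_algebraMap_iff.mpr inferInstance
  obtain ⟨hflat, hsurj⟩ := RingHom.FaithfullyFlat.iff_flat_and_comap_surjective.mp hff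
  obtain ⟨𝔔, h𝔔⟩ := hsurj ⟨𝔓', ‹_›⟩
  have h𝔓' : 𝔓' = Ideal.comap ι 𝔔.asIdeal := by
    have := congrArg PrimeSpectrum.asIdeal h𝔔
    rw [PrimeSpectrum.comap_asIdeal] at this
    exact this.symm
  have hf : (Localization.localRingHom 𝔓' 𝔔.asIdeal ι h𝔓').Flat :=
    hflat.localRingHom 𝔔.asIdeal 𝔓' h𝔓'
  haveI : IsLocalHom (Localization.localRingHom 𝔓' 𝔔.asIdeal ι h𝔓') :=
    Localization.isLocalHom_localRingHom 𝔓' 𝔔.asIdeal ι h𝔓'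
  haveI := hreg 𝔔
  exact IsRegularLocalRing.of_flat_ringHom _ hf

end Ring

/-! ## Finitely generated subfields: every finite subset of `B ⊗_L k` comes from a finite level -/

/-- Finitely many elements of `B ⊗_L k` involve only finitely many scalars of `k`: for a finite
`S ⊆ B ⊗_L k` there is a finitely generated subfield `L ≤ L' = closure t' ⊆ k` such that every
element of `S` is a finite sum of tensors `b ⊗ c` with `c ∈ L'`. -/
theorem exists_subfield_finset_sum_tmul (k : Type u) [Field k] (L : Subfield k) (t : Finset k)
    (hLt : L = Subfield.closure (↑t : Set k)) {B : Type u} [CommRing B] [Algebra L B]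
    (S : Finset (B ⊗[L] k)) :
    ∃ (L' : Subfield k) (_ : L ≤ L') (t' : Finset k), L' = Subfield.closure (↑t' : Set k) ∧
      ∀ g ∈ S, ∃ F : Finset (B × k), (∀ i ∈ F, i.2 ∈ L') ∧ g = ∑ i ∈ F, i.1 ⊗ₜ[L] i.2 := by
  classical
  choose F hF using fun g : B ⊗[L] k => TensorProduct.exists_finset (R := L) g
  let C : Finset k := S.biUnion fun g => (F g).image Prod.snd
  refine ⟨Subfield.closure (↑(t ∪ C) : Set k), ?_, t ∪ C, rfl, ?_⟩
  · rw [hLt]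
    exact Subfield.closure_mono (by simp [Finset.coe_union])
  · intro g hg
    refine ⟨F g, fun i hi => Subfield.subset_closure ?_, hF g⟩
    rw [Finset.coe_union]
    refine Set.mem_union_right _ ?_
    simp only [Finset.mem_coe, C, Finset.mem_biUnion, Finset.mem_image]
    exact ⟨g, hg, i, hi, rfl⟩

/-! ## The theorem -/

/-- **Regularity of `Y ×_L k` from regularity over an overfield of every finite level**
(universe-polymorphic form of the stub, with the structure map written `specOfAlgebra L k`):
see the module docstring for the proof. -/
theorem isRegular_pullback_of_finiteLevels (k : Type u) [Field k] (L : Subfield k) (t : Finset k)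
    (hLt : L = Subfield.closure (↑t : Set k)) (Y : Scheme.{u}) (q : Y ⟶ Spec (.of L))
    [LocallyOfFiniteType q]
    (hfin : ∀ (L' : Subfield k) (hL' : L ≤ L') (t' : Finset k),
      L' = Subfield.closure (↑t' : Set k) → ∃ (Ω : Type u) (_ : Field Ω) (φ : L' →+* Ω),
        Scheme.IsRegular
          (pullback q (Spec.map (CommRingCat.ofHom (φ.comp (Subfield.inclusion hL')))))) :
    Scheme.IsRegular (pullback q (specOfAlgebra L k)) := by
  classical
  intro y
  -- Step 1: an affine chart `Spec B ↪ Y` at the image of `y`, `B` of finite type over `L`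
  obtain ⟨W, hW, hyW, -⟩ := exists_isAffineOpen_mem_and_subset (X := Y)
    (x := pullback.fst q (specOfAlgebra L k) y) (U := ⊤) trivial
  let iW : Spec Γ(Y, W) ⟶ Y := hW.fromSpec
  let φ₀ : CommRingCat.of (L : Type u) ⟶ Γ(Y, W) := Spec.preimage (iW ≫ q)
  letI : Algebra L Γ(Y, W) := φ₀.hom.toAlgebra
  have hi : iW ≫ q = Spec.map (CommRingCat.ofHom (algebraMap L Γ(Y, W))) := by
    rw [RingHom.algebraMap_toAlgebra, CommRingCat.ofHom_hom, Spec.map_preimage]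
  haveI : Algebra.FiniteType L Γ(Y, W) := by
    have h1 : LocallyOfFiniteType (Spec.map (CommRingCat.ofHom (algebraMap L Γ(Y, W)))) := by
      rw [← hi]; infer_instance
    have h2 := (HasRingHomProperty.Spec_iff (P := @LocallyOfFiniteType)).mp h1
    exact RingHom.finiteType_algebraMap.mp h2
  haveI : IsNoetherianRing (Γ(Y, W) ⊗[L] k) := isNoetherianRing_tensor_of_finiteType k Γ(Y, W)
  -- `y` lies in the chart `Spec (B ⊗_L k)`
  let c := specTensorChart k q iW hi
  have hyrange : y ∈ Set.range c := by
    change y ∈ Set.range (specTensorChart k q iW hi)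
    rw [range_specTensorChart, Set.mem_preimage, IsAffineOpen.range_fromSpec]
    exact hyW
  obtain ⟨ζ, hζ⟩ := hyrange
  suffices hreg : IsRegularLocalRing (Localization.AtPrime ζ.asIdeal) by
    rw [← hζ]
    exact (isRegularLocalRing_stalk_iff_of_isOpenImmersion c ζ).mpr
      ((isRegularLocalRing_stalk_Spec_iff _ ζ).mpr hreg)
  -- Step 2: the prime `ζ` is extended from a finite level `L'`
  obtain ⟨S, hS⟩ := (IsNoetherian.noetherian ζ.asIdeal : ζ.asIdeal.FG)
  obtain ⟨L', hL', t', hL't', hmem⟩ := exists_subfield_finset_sum_tmul k L t hLt S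
  letI : Algebra L L' := (Subfield.inclusion hL').toAlgebra
  haveI : IsScalarTower L L' k := IsScalarTower.of_algebraMap_eq fun _ => rfl
  set ι := (Algebra.TensorProduct.lTensor (S := (L : Type u)) Γ(Y, W)
    (IsScalarTower.toAlgHom L L' k)).toRingHom with hι
  have hSsub : (↑S : Set (Γ(Y, W) ⊗[L] k)) ⊆ SetLike.coe ((ζ.asIdeal.comap ι).map ι) := by
    intro g hg
    obtain ⟨F, hF, rfl⟩ := hmem g hg
    obtain ⟨x, hx⟩ : ∑ i ∈ F, i.1 ⊗ₜ[L] i.2 ∈ Set.range ι :=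
      sum_tmul_mem_range_lTensor F fun i hi => ⟨⟨i.2, hF i hi⟩, rfl⟩
    rw [← hx]
    refine Ideal.mem_map_of_mem ι ?_
    rw [Ideal.mem_comap, hx, ← hS]
    exact Submodule.subset_span hg
  have hgen : ζ.asIdeal ≤ (ζ.asIdeal.comap ι).map ι :=
    calc ζ.asIdeal = Submodule.span _ ↑S := hS.symm
      _ ≤ _ := Submodule.span_le.mpr hSsub
  refine isRegularLocalRing_localization_of_le_map_comap ζ.asIdeal hgen ?_
  -- Step 3: the finite level `L'` is regular at `ζ ∩ (B ⊗_L L')`, by descent from `Ω`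
  obtain ⟨Ω, _, φ, hΩ⟩ := hfin L' hL' t' hL't'
  letI : Algebra L' Ω := φ.toAlgebra
  letI : Algebra L Ω := (φ.comp (Subfield.inclusion hL')).toAlgebra
  haveI : IsScalarTower L L' Ω := IsScalarTower.of_algebraMap_eq fun _ => rfl
  haveI : IsNoetherianRing (Γ(Y, W) ⊗[L] L') := isNoetherianRing_tensor_of_finiteType L' Γ(Y, W)
  refine isRegularLocalRing_localization_of_overfield (Ω := Ω) (fun 𝔔 => ?_) _
  let cΩ := specTensorChart Ω q iW hi
  have h1 : IsRegularLocalRing ((pullback q (specOfAlgebra L Ω)).presheaf.stalk (cΩ 𝔔)) :=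
    hΩ (cΩ 𝔔)
  exact (isRegularLocalRing_stalk_Spec_iff _ 𝔔).mp
    ((isRegularLocalRing_stalk_iff_of_isOpenImmersion cΩ 𝔔).mp h1)

-- registered signature; `QuasiCompact q` is not needed
/-- **REGULARITY OF THE LIMIT** (stub `stub_regularOfFiniteLevels`): if `Y → Spec L` is of finite
type, `L = closure t ⊆ k` finitely generated, and for every finitely generated `L ≤ L' ⊆ k` the
base change of `Y` to some overfield `Ω` of `L'` is regular, then `Y ×_L k` is regular. -/
theorem stub_regularOfFiniteLevels : ∀ (k : Type) [Field k] (L : Subfield k) (t : Finset k), L = Subfield.closure (↑t : Set k) → ∀ (Y : Scheme.{0}) (q : Y ⟶ Spec (.of L)), LocallyOfFiniteType q → QuasiCompact q → (∀ (L' : Subfield k) (hL' : L ≤ L') (t' : Finset k), L' = Subfield.closure (↑t' : Set k) → ∃ (Ω : Type) (_ : Field Ω) (φ : L' →+* Ω), Scheme.IsRegular (pullback q (Spec.map (CommRingCat.ofHom (φ.comp (Subfield.inclusion hL')))))) → Scheme.IsRegular (pullback q (Spec.map (CommRingCat.ofHom L.subtype))) := by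
  intro k _ L t hLt Y q _ _ hfin
  exact isRegular_pullback_of_finiteLevels k L t hLt Y q hfin

end Summit.ResolutionOfSingularities.ResolutionOfSingularities.Theorems

end
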